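import Summits.CriticalPhenomena.SAWScalingLimit.Theses.SAWWeldingIdentification
import Summits.CriticalPhenomena.SAWScalingLimit.Theses.SAWLoopFugacityFlow
import Literature.Probability.RandomPlanarGeometry.ConformalRemovabilityLocal
import HarnessLib

/-!
# Crux `RemovableLimit` (stmt-CriticalPhenomena-4503) — line `birth` / `registered`, skeleton v2

Route `SAWWeldingIdentification` (sub-problem `SAWScalingLimit`), crux (R) `RemovableLimit`: for
every conformal rectangle `Q` (Dobrushin domain `Q.chord 0 2 = (Ω; a, b)`, `Ω = Q.carrier`,
`a = Q.pt 0`, `b = Q.pt 2`), every endpoint approximation `(a_δ, b_δ)` and every probability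
measure `P` on `CurveClass ℂ` that is a weak limit of the pushed-forward critical SAW laws along
some `δ_n → 0⁺`, `P`-almost every curve is a SIMPLE CHORD of `(Ω; a, b)` that is CONFORMALLY
REMOVABLE inside `Ω` (the clause inlined in the crux is `IsConformallyRemovableIn.self_maps`).

## The line: simple chord + (conformally-)locally Hölder banks ⟹ removable (Jones–Smirnov, local)

This is the glued split foreseen in the route header (TWO-LAYER PLAN: `RemovableLimit ⇐
SimpleBoundaryAvoidingLimit → HölderBanks → RemovableLimit`, glue = Jones–Smirnov, local form),
typed over tree vocabulary:

* **S1 `stub_simpleChordLimit`** — `P`-a.e. the limit curve is a simple chord of `(Ω; a, b)`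
  (simple, from `a` to `b`, inside `Ω̄`, meeting `∂Ω` only at `a, b`). It is the
  conformal-rectangle framing of the SHARED crux `SAWLoopFugacityFlow.SimpleSubseqLimits`
  (stmt-CriticalPhenomena-4982): `simpleChordLimit_of_simpleSubseqLimits` below PROVES
  `SimpleSubseqLimits → S1` (specialise `D := Q.chord 0 2`; `δ_n > 0 ∧ δ_n → 0` is `δ_n → 0⁺`),
  and the converse holds too (every Dobrushin domain is `Q.chord 0 2` of a conformal rectangle;
  lead c1 pin file). So S1 ≡ stmt-4982: research-open (nine lead seats, terminal verdict
  `open-problem`, residual `PastFutureAvoidance`).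
* **S2' `stub_confHolderBanksLimit`** (v2, lead c1; replaces v1 `stub_holderBanksLimit`) — `P`-a.e.,
  IF the limit curve `γ` is a simple chord THEN it is CONFORMALLY-LOCALLY HÖLDER-BANKED in `Ω`:
  every point of `γ ∩ Ω` has an open neighbourhood `U ⊆ Ω`, a conformal chart `Ψ : V → U` from an
  open set `V`, and a Hölder domain `H` (`IsHolderDomain`, Jones–Smirnov 2000 p. 266) with
  `γ ∩ U ⊆ Ψ(∂H ∩ V)` — "no fjords at any scale" for a local piece of ONE bank, read in ANY
  conformal chart. WHY THE RESHAPE: v1 asked for a Hölder domain `H ⊆ ℂ` with `γ ∩ U ⊆ ∂H` in the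
  `Ω`-picture itself; Hölder-ness is neither local nor conformally invariant, and the carrier of a
  conformal rectangle is an arbitrary Jordan domain (its Riemann map need not be Hölder), so even
  for the SLE₈/₃ value of the limit v1 is certified only through an extra "Hölder sub-domain at a
  boundary arc" lemma that nothing else needs. v2 is implied by v1 (`isConfLocallyHolderBanked` with
  `Ψ = refl`), is exactly what Rohde–Schramm 2005 Thm 5.2 delivers for SLE₈/₃ chords of `Q`
  (chart = uniformiser ∘ Cayley⁻¹, `H` = Cayley image of the Loewner domain `ℍ ∖ γ(0, T]`; lead c1
  sanity pin `SAWWeldingIdentificationRemovableLimitSLEBanks.lean`), is what a lattice engine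
  (uniform Hölder/John banks of the walk in the DISC picture of `Ω`) would deliver, and feeds the
  same glue through the conformal invariance of removability. Size: XL / open (uniform no-fjord
  estimates for the banks of the critical ℤ² walk; only sub-ballisticity, DCH13, is in print).
* **Glue, PROVED here (no `sorry`)**: local Jones–Smirnov
  `IsHolderDomain.isConformallyRemovableIn_frontier` (boundaries of Hölder domains are removable
  inside EVERY open set) + conformal invariance `image_conformalEquiv` + `anti` + locality
  `of_forall_nhds` ⟹ a closed, conformally-locally Hölder-banked set is conformally removable inside
  the open set `Ω` (`isConformallyRemovableIn_of_isConfLocallyHolderBanked`); `self_maps` gives the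
  clause of the crux, and `RemovableLimit_of` intersects the two full-measure events.

## Audit shape

`sorry` occurs in exactly the two stubs `stub_simpleChordLimit`, `stub_confHolderBanksLimit`
(stated over TREE VOCABULARY ONLY, so that each can land verbatim as
`Theorems/SAWWeldingIdentificationRemovableLimit<Stub>.lean --supports stmt-CriticalPhenomena-4503`
without importing this workfile); `simpleChordLimit_holds` / `confHolderBanksLimit_holds` certify
definitionally that the unfolded stub texts ARE the named statements `SimpleChordLimit`,
`ConfHolderBanksLimit`; the skeleton theorem `RemovableLimit_of` takes the two stubs under their
registered names (`Registered.stub_*`, reducible aliases) and concludes the ROUTE DECL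
`Summit.CriticalPhenomena.SAWScalingLimit.Theses.SAWWeldingIdentification.RemovableLimit` by name;
the closing `example` wires the stubs as stated into it. The v1 statement `HolderBanksLimit` is
kept as a definition with the proved implication `confHolderBanksLimit_of_holderBanksLimit`
(v1 ⇒ v2), so a proof of the v1 stub still closes the line.

## Disproof used

No `Disproof.lean` / `Theorems/RemovableLimit/Negative/*` exists for this crux (2026-08-17). Both
stubs keep EVERY hypothesis of the crux verbatim (endpoint approximation with `tendsto_fst/snd` and
`reachable`, `IsProbabilityMeasure P`, `0 < δ_n`, `δ_n → 0`, weak convergence), so the sibling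
obstructions recorded in `Cruxes/SimpleSubseqLimits/Disproof.lean`
(`simpleSubseqLimits_false_without_tendsto_fst/snd`, `crux_false_without_meshLimit`,
`crux_false_without_weakLimit`, `crux_false_without_isProbability_and_reachable`) are honoured by
S1 (and by S2', which is moreover conditional on the simple-chord event).

## References

[JonesSmirnov2000] Cor. 2 (p. 267), Def. 1 (p. 263); [RohdeSchramm2005] Thm 5.2, Thm 6.1;
[Younsi2018]; [DuminilCopinHammond2013]; [KennedyLawler2013]; [LawlerSchrammWerner2004SAW] §3.4.2.
-/

open MeasureTheory Filter Set
open scoped Topology NNReal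
open Literature.Probability.RandomPlanarGeometry Literature.Probability.LatticeModels
open Summit.CriticalPhenomena.SAWScalingLimit.Theses.SAWWeldingIdentification (RemovableLimit)

namespace Summit.CriticalPhenomena.SAWScalingLimit.Cruxes.RemovableLimit.Birth

/-! ### Vocabulary of the line (local names; the stubs below unfold them by hand) -/

/-- `γ` is a **simple chord** of the Dobrushin domain `(Q.carrier; Q.pt 0, Q.pt 2)`: simple, from
`Q.pt 0` to `Q.pt 2`, inside the closed domain, meeting the frontier only at its endpoints — the
first conjunct of the crux, verbatim. -/
def IsSimpleChord (Q : ConformalRectangle) (γ : CurveClass ℂ) : Prop :=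
  γ ∈ CurveClass.simple ∧ γ.source = Q.pt 0 ∧ γ.target = Q.pt 2 ∧ γ.range ⊆ closure Q.carrier ∧
    γ.range ∩ frontier Q.carrier ⊆ {Q.pt 0, Q.pt 2}

/-- (v1) `K` is **locally Hölder-banked in `Ω`**: every point of `K ∩ Ω` has an open neighbourhood
`U ⊆ Ω` and a Hölder domain `H` (Jones–Smirnov 2000, p. 266; tree `IsHolderDomain`) whose frontier
contains `K ∩ U`. -/
def IsLocallyHolderBanked (Ω K : Set ℂ) : Prop :=
  ∀ z ∈ K ∩ Ω, ∃ U : Set ℂ, IsOpen U ∧ z ∈ U ∧ U ⊆ Ω ∧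
    ∃ H : Set ℂ, IsHolderDomain H ∧ K ∩ U ⊆ frontier H

/-- (v2) `K` is **conformally-locally Hölder-banked in `Ω`**: every point of `K ∩ Ω` has an open
neighbourhood `U ⊆ Ω` that is the target of a conformal chart `Ψ : V → U` from an open set `V`, and
a Hölder domain `H`, such that `K ∩ U ⊆ Ψ(∂H ∩ V)`. With `V = U`, `Ψ = refl` this is v1; the chart
makes the notion local and conformally invariant (like removability itself), so it can be read in
the disc / half-plane picture of `Ω`. -/
def IsConfLocallyHolderBanked (Ω K : Set ℂ) : Prop :=
  ∀ z ∈ K ∩ Ω, ∃ U : Set ℂ, IsOpen U ∧ z ∈ U ∧ U ⊆ Ω ∧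
    ∃ (V : Set ℂ) (Ψ : ConformalEquiv V U) (H : Set ℂ), IsOpen V ∧ IsHolderDomain H ∧
      K ∩ U ⊆ Ψ '' (frontier H ∩ V)

/-- **S1 as a named statement**: every subsequential weak limit `P` of the critical SAW laws in
`(Q; a_δ, b_δ)` is carried by simple chords of `(Q.carrier; Q.pt 0, Q.pt 2)` (hypotheses = those
of the crux, verbatim). -/
def SimpleChordLimit : Prop :=
  ∀ (Q : ConformalRectangle) (a b : ℝ → Site 2), SAW.IsEndpointApprox (Q.chord 0 2 (by decide)) a b →
    ∀ (P : Measure (CurveClass ℂ)), IsProbabilityMeasure P → ∀ (δs : ℕ → ℝ), (∀ n, 0 < δs n) →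
    Tendsto δs atTop (𝓝 0) →
    (∀ f : BoundedContinuousFunction (CurveClass ℂ) ℝ,
      Tendsto (fun n => ∫ γ, f γ.curve ∂(SAW.law Q.carrier (δs n) (a (δs n)) (b (δs n)))) atTop
        (𝓝 (∫ γ, f γ ∂P))) →
    ∀ᵐ γ ∂P, IsSimpleChord Q γ

/-- **S2 (v1) as a named statement**: every subsequential weak limit `P` of the critical SAW laws
in `(Q; a_δ, b_δ)` is carried by curves which, if simple chords, are locally Hölder-banked in
`Q.carrier`. Kept for the record (v1 ⇒ v2, `confHolderBanksLimit_of_holderBanksLimit`). -/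
def HolderBanksLimit : Prop :=
  ∀ (Q : ConformalRectangle) (a b : ℝ → Site 2), SAW.IsEndpointApprox (Q.chord 0 2 (by decide)) a b →
    ∀ (P : Measure (CurveClass ℂ)), IsProbabilityMeasure P → ∀ (δs : ℕ → ℝ), (∀ n, 0 < δs n) →
    Tendsto δs atTop (𝓝 0) →
    (∀ f : BoundedContinuousFunction (CurveClass ℂ) ℝ,
      Tendsto (fun n => ∫ γ, f γ.curve ∂(SAW.law Q.carrier (δs n) (a (δs n)) (b (δs n)))) atTop
        (𝓝 (∫ γ, f γ ∂P))) →
    ∀ᵐ γ ∂P, IsSimpleChord Q γ → IsLocallyHolderBanked Q.carrier γ.range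

/-- **S2' (v2) as a named statement**: every subsequential weak limit `P` of the critical SAW laws
in `(Q; a_δ, b_δ)` is carried by curves which, if simple chords, are conformally-locally
Hölder-banked in `Q.carrier`. -/
def ConfHolderBanksLimit : Prop :=
  ∀ (Q : ConformalRectangle) (a b : ℝ → Site 2), SAW.IsEndpointApprox (Q.chord 0 2 (by decide)) a b →
    ∀ (P : Measure (CurveClass ℂ)), IsProbabilityMeasure P → ∀ (δs : ℕ → ℝ), (∀ n, 0 < δs n) →
    Tendsto δs atTop (𝓝 0) →
    (∀ f : BoundedContinuousFunction (CurveClass ℂ) ℝ,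
      Tendsto (fun n => ∫ γ, f γ.curve ∂(SAW.law Q.carrier (δs n) (a (δs n)) (b (δs n)))) atTop
        (𝓝 (∫ γ, f γ ∂P))) →
    ∀ᵐ γ ∂P, IsSimpleChord Q γ → IsConfLocallyHolderBanked Q.carrier γ.range

/-! ### The stubs (the ONLY `sorry`s of the file), over tree vocabulary only -/

/-- **S1 (stub) — simple chords carry every subsequential SAW limit.** For every conformal
rectangle `Q`, endpoint approximation `(a_δ, b_δ)` of `(Q.pt 0, Q.pt 2)` and probability measure
`P` that is the weak limit of the pushed-forward critical SAW laws of `(Q.carrier; a_δ, b_δ)` along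
some `δ_n > 0`, `δ_n → 0`: `P`-a.e. curve is simple, runs from `Q.pt 0` to `Q.pt 2` inside the
closed domain and meets the frontier only at these two points. Conformal-rectangle framing of the
shared crux `SimpleSubseqLimits` (stmt-CriticalPhenomena-4982), see
`simpleChordLimit_of_simpleSubseqLimits`; equivalent to it. Open (LSW 2004 §3.4.2; Kennedy–Lawler
2013; Duminil-Copin–Hammond 2013 sub-ballisticity is the only input in print). -/
theorem stub_simpleChordLimit :
    ∀ (Q : ConformalRectangle) (a b : ℝ → Site 2), SAW.IsEndpointApprox (Q.chord 0 2 (by decide)) a b →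
    ∀ (P : Measure (CurveClass ℂ)), IsProbabilityMeasure P → ∀ (δs : ℕ → ℝ), (∀ n, 0 < δs n) →
    Tendsto δs atTop (𝓝 0) →
    (∀ f : BoundedContinuousFunction (CurveClass ℂ) ℝ,
      Tendsto (fun n => ∫ γ, f γ.curve ∂(SAW.law Q.carrier (δs n) (a (δs n)) (b (δs n)))) atTop
        (𝓝 (∫ γ, f γ ∂P))) →
    ∀ᵐ γ ∂P, γ ∈ CurveClass.simple ∧ γ.source = Q.pt 0 ∧ γ.target = Q.pt 2 ∧
      γ.range ⊆ closure Q.carrier ∧ γ.range ∩ frontier Q.carrier ⊆ {Q.pt 0, Q.pt 2} := by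
  sorry

/-- **S2' (stub, v2) — conformally-local Hölder banks of the SAW limit (no fjords at any scale, in
a conformal chart).** For every conformal rectangle `Q`, endpoint approximation and subsequential
weak limit `P` as in S1: for `P`-a.e. curve `γ`, if `γ` is a simple chord of
`(Q.carrier; Q.pt 0, Q.pt 2)` then every point of `γ.range ∩ Q.carrier` has an open neighbourhood
`U ⊆ Q.carrier`, an open set `V` with a conformal equivalence `Ψ : V → U`, and a Hölder domain `H`
(`IsHolderDomain H`: some conformal equivalence from the unit disc onto `H` is Hölder continuous on
the disc) with `γ.range ∩ U ⊆ Ψ '' (frontier H ∩ V)`. For the SLE₈/₃ value of the limit this is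
Rohde–Schramm 2005 Thm 5.2 read through the uniformiser (chart `Ψ = φ ∘ Cayley⁻¹`, `H` = Cayley
image of `ℍ ∖ γ(0, T]`). Intended engine: uniform Hölder/John estimates for the two banks of the
critical walk at all scales in the disc picture of `Ω`, passed to the limit. Open (XL). -/
theorem stub_confHolderBanksLimit :
    ∀ (Q : ConformalRectangle) (a b : ℝ → Site 2), SAW.IsEndpointApprox (Q.chord 0 2 (by decide)) a b →
    ∀ (P : Measure (CurveClass ℂ)), IsProbabilityMeasure P → ∀ (δs : ℕ → ℝ), (∀ n, 0 < δs n) →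
    Tendsto δs atTop (𝓝 0) →
    (∀ f : BoundedContinuousFunction (CurveClass ℂ) ℝ,
      Tendsto (fun n => ∫ γ, f γ.curve ∂(SAW.law Q.carrier (δs n) (a (δs n)) (b (δs n)))) atTop
        (𝓝 (∫ γ, f γ ∂P))) →
    ∀ᵐ γ ∂P, (γ ∈ CurveClass.simple ∧ γ.source = Q.pt 0 ∧ γ.target = Q.pt 2 ∧
      γ.range ⊆ closure Q.carrier ∧ γ.range ∩ frontier Q.carrier ⊆ {Q.pt 0, Q.pt 2}) →
      ∀ z ∈ γ.range ∩ Q.carrier, ∃ U : Set ℂ, IsOpen U ∧ z ∈ U ∧ U ⊆ Q.carrier ∧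
        ∃ (V : Set ℂ) (Ψ : ConformalEquiv V U) (H : Set ℂ), IsOpen V ∧ IsHolderDomain H ∧
          γ.range ∩ U ⊆ Ψ '' (frontier H ∩ V) := by
  sorry

/-! ### Consistency: each unfolded stub IS its named statement (definitionally) -/

/-- `SimpleChordLimit` is the stub S1, verbatim up to unfolding `IsSimpleChord`. -/
theorem simpleChordLimit_holds : SimpleChordLimit := stub_simpleChordLimit

/-- `ConfHolderBanksLimit` is the stub S2', verbatim up to unfolding `IsSimpleChord` and
`IsConfLocallyHolderBanked`. -/
theorem confHolderBanksLimit_holds : ConfHolderBanksLimit := stub_confHolderBanksLimit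

/-! ### Registered names of the stub statements

The skeleton audit admits as hypotheses of `RemovableLimit_of` only propositions whose head
constant is NAMED like a declared stub, so each statement gets a reducible alias carrying its
stub's name. -/
namespace Registered

/-- `SimpleChordLimit`, under the name of its stub. -/
abbrev stub_simpleChordLimit : Prop := SimpleChordLimit
/-- `ConfHolderBanksLimit`, under the name of its stub. -/
abbrev stub_confHolderBanksLimit : Prop := ConfHolderBanksLimit

end Registered

/-! ### Proved rungs -/

/-- **S1 follows from the shared crux `SimpleSubseqLimits`** (stmt-CriticalPhenomena-4982 of route
`SAWLoopFugacityFlow`): specialise the Dobrushin domain to `Q.chord 0 2` (same carrier, marked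
points `Q.pt 0`, `Q.pt 2` by `rfl`) and note that `δ_n > 0`, `δ_n → 0` is `δ_n → 0⁺`. So S1 is not
new work: any proof of stmt-4982 discharges it. [folklore] -/
theorem simpleChordLimit_of_simpleSubseqLimits
    (h : Summit.CriticalPhenomena.SAWScalingLimit.Theses.SAWLoopFugacityFlow.SimpleSubseqLimits) :
    SimpleChordLimit := by
  intro Q a b hab P hP δs hpos hδ hlim
  have hδ' : Tendsto δs atTop (𝓝[>] (0 : ℝ)) :=
    tendsto_nhdsWithin_iff.2 ⟨hδ, Eventually.of_forall hpos⟩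
  exact h (Q.chord 0 2 (by decide)) a b hab δs P hδ' hP hlim

/-- **v1 ⇒ v2 for the bank condition**: a locally Hölder-banked set is conformally-locally
Hölder-banked (chart `Ψ = refl U`, `V = U`). [folklore] -/
theorem isConfLocallyHolderBanked_of_isLocallyHolderBanked {Ω K : Set ℂ}
    (h : IsLocallyHolderBanked Ω K) : IsConfLocallyHolderBanked Ω K := by
  intro z hz
  obtain ⟨U, hU, hzU, hUΩ, H, hH, hKU⟩ := h z hz
  refine ⟨U, hU, hzU, hUΩ, U, ConformalEquiv.refl U, H, hU, hH, ?_⟩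
  intro w hw
  exact ⟨w, ⟨hKU hw, hw.2⟩, ConformalEquiv.refl_apply U w⟩

/-- **v1 ⇒ v2 for the stub statements**: `HolderBanksLimit → ConfHolderBanksLimit`, so a proof of
the v1 stub still closes the line. [folklore] -/
theorem confHolderBanksLimit_of_holderBanksLimit (h : HolderBanksLimit) : ConfHolderBanksLimit := by
  intro Q a b hab P hP δs hpos hδ hlim
  filter_upwards [h Q a b hab P hP δs hpos hδ hlim] with γ hγ hs
  exact isConfLocallyHolderBanked_of_isLocallyHolderBanked (hγ hs)

/-- **The Jones–Smirnov transfer, local form (v1)**: a closed set that is locally Hölder-banked in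
an open set `Ω` is conformally removable inside `Ω`. Proof: at each point of `K ∩ Ω`, inside the
neighbourhood `U` the set `K ∩ U` lies on the frontier of a Hölder domain, which is removable
inside every open set (tree theorem `IsHolderDomain.isConformallyRemovableIn_frontier`,
Jones–Smirnov 2000 Cor. 2 in local form), hence so is `K ∩ U` (`anti`, `iff_inter`); removability
is local for closed sets in open sets (`of_forall_nhds`). [cite: JonesSmirnov2000, Cor. 2] -/
theorem isConformallyRemovableIn_of_isLocallyHolderBanked {Ω K : Set ℂ} (hΩ : IsOpen Ω)
    (hK : IsClosed K) (h : IsLocallyHolderBanked Ω K) : IsConformallyRemovableIn Ω K := by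
  refine IsConformallyRemovableIn.of_forall_nhds hΩ hK fun z hz => ?_
  obtain ⟨U, hU, hzU, hUΩ, H, hH, hKU⟩ := h z hz
  exact ⟨U, hU, hzU, hUΩ,
    IsConformallyRemovableIn.iff_inter.2 ((hH.isConformallyRemovableIn_frontier hU).anti hKU)⟩

/-- **The Jones–Smirnov transfer, conformally-local form (v2)**: a closed set that is
conformally-locally Hölder-banked in an open set `Ω` is conformally removable inside `Ω`. Proof: at
each point of `K ∩ Ω`, `K ∩ U ⊆ Ψ(∂H ∩ V)`; `∂H` is removable inside the open set `V` (local
Jones–Smirnov, `IsHolderDomain.isConformallyRemovableIn_frontier`), removability is conformally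
invariant (`image_conformalEquiv` along `Ψ : V → U`) and antitone (`anti`, `iff_inter`), and local
for closed sets in open sets (`of_forall_nhds`). [cite: JonesSmirnov2000, Cor. 2 and p. 264] -/
theorem isConformallyRemovableIn_of_isConfLocallyHolderBanked {Ω K : Set ℂ} (hΩ : IsOpen Ω)
    (hK : IsClosed K) (h : IsConfLocallyHolderBanked Ω K) : IsConformallyRemovableIn Ω K := by
  refine IsConformallyRemovableIn.of_forall_nhds hΩ hK fun z hz => ?_
  obtain ⟨U, hU, hzU, hUΩ, V, Ψ, H, hV, hH, hKU⟩ := h z hz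
  exact ⟨U, hU, hzU, hUΩ, IsConformallyRemovableIn.iff_inter.2
    (((hH.isConformallyRemovableIn_frontier hV).image_conformalEquiv Ψ).anti hKU)⟩

/-- For a curve class: a conformally-locally Hölder-banked trace is removable inside the (open)
carrier of a conformal rectangle, in the very clause inlined by the crux (`self_maps` form).
[folklore] -/
theorem removableClause_of_isConfLocallyHolderBanked (Q : ConformalRectangle) (γ : CurveClass ℂ)
    (h : IsConfLocallyHolderBanked Q.carrier γ.range) :
    ∀ F : ℂ → ℂ, ContinuousOn F Q.carrier → Set.InjOn F Q.carrier → F '' Q.carrier = Q.carrier →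
      DifferentiableOn ℂ F (Q.carrier \ γ.range) → DifferentiableOn ℂ F Q.carrier :=
  (isConformallyRemovableIn_of_isConfLocallyHolderBanked Q.isOpen
    (CurveClass.isCompact_range γ).isClosed h).self_maps

/-! ### The skeleton theorem: the two stubs imply the crux, BY NAME -/

/-- **`RemovableLimit` from the line `birth` (v2)** (kernel-checked, no `sorry` of its own):
intersect the full-measure events of S1 (simple chord) and S2' (simple chord ⟹ conformally-locally
Hölder-banked) and apply the proved Jones–Smirnov transfer. Hypotheses = the two stubs under their
registered names; conclusion = the route decl
`Summit.CriticalPhenomena.SAWScalingLimit.Theses.SAWWeldingIdentification.RemovableLimit`. -/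
theorem RemovableLimit_of (h1 : Registered.stub_simpleChordLimit)
    (h2 : Registered.stub_confHolderBanksLimit) : RemovableLimit := by
  intro Q a b hab P hP δs hpos hδ hlim
  filter_upwards [h1 Q a b hab P hP δs hpos hδ hlim, h2 Q a b hab P hP δs hpos hδ hlim] with γ hγ hH
  exact ⟨hγ, removableClause_of_isConfLocallyHolderBanked Q γ (hH hγ)⟩

/-- **Wiring check**: the stubs AS STATED feed the skeleton theorem (this term becomes the crux
proof once the two `sorry`s above are discharged). -/
example : RemovableLimit := RemovableLimit_of stub_simpleChordLimit stub_confHolderBanksLimit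

/-- **Wiring check (v1 route still closes)**: S1 together with the v1 statement
`HolderBanksLimit` also gives the crux. -/
example (h1 : SimpleChordLimit) (h2 : HolderBanksLimit) : RemovableLimit :=
  RemovableLimit_of h1 (confHolderBanksLimit_of_holderBanksLimit h2)

end Summit.CriticalPhenomena.SAWScalingLimit.Cruxes.RemovableLimit.Birth
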